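import Summits.AnomalousDissipation.AnomalousDissipation.Theorems.SawtoothPulseCascadeApproxForcedProfile
import Literature.Analysis.FunctionSpaces.TorusFourierCalculus

/-!
# Derivatives of the forced heat profiles: Fourier coefficients and the pointwise Lipschitz size
(route `AnomalousDissipation/SawtoothPulseCascade`; helper for the crux ApproxSol58 =
stmt-AnomalousDissipation-19688, S2 `stub_responseLipEnvelope` of the lead's reshaped line `linear-response-lip`:
the realignment pipeline of `…ApproxForcedProfile` / `…ApproxRealign` read in the LIPSCHITZ norm)

The `L²` pipeline (support g5, `…ApproxForcedProfile`) bounds a forced heat profile `F` from zero datum with the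
separated source `r(t) · κ u''(y)` (`u(y) = roundedSaw δ (2πNy)/(2πN)`) pointwise by `6√(2π)|κ|N(∫|r|)/δ`.  For the
Lipschitz envelope of the linearised response we need the `y`-DERIVATIVE of the same profiles:

* §1 `𝓕(U')(m) = 2πi m · 𝓕(U)(m)` for smooth `1`-periodic profiles (tree `Torus.mFourierCoeff_partialDeriv` on `𝕋¹`);
* §2 the first Gaussian moment over the odd integers, `Σ_{n ∈ ℤ} |2n+1| e^{−a(2n+1)²} ≤ √(2π)/a`
  (`|x| e^{−ax²} ≤ e^{−ax²/2}/√a` and the tree's `Σ e^{−(a/2)(2n+1)²} ≤ √(2π/a)`);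
* §3 `|∂_y F(t, y)| ≤ 24π√(2π) · |κ| N² (∫ₐᵗ|r|) / δ²` (coefficients on the odd multiples `(2n+1)N` with the Gaussian
  factor `e^{−δ²(2n+1)²/2}`, weighted by `2π|m| = 2π(2n+1)N`).

For the cascade (`κ = ν`, `∫|r| ≤ γ`) this is `≈ 189 νγ N_j²/δ_j²`: the datum size `D₁` of the per-phase Lipschitz cap
`K2LipschitzGrowthClassical` for the realigned comb injections, and the Lipschitz size of the running slot's own parallel
profile.
-/

set_option linter.dupNamespace false

noncomputable section

namespace Summit.AnomalousDissipation.AnomalousDissipation.Theorems.SawtoothPulseCascade.ApproxResponse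

open Set MeasureTheory Complex
open scoped ContDiff
open Literature.Analysis Literature.Analysis.FunctionSpaces Literature.Analysis.FluidPDE
open Literature.Analysis.FluidPDE.SawtoothCascade
open Summit.AnomalousDissipation.AnomalousDissipation.Theorems.SawtoothPulseCascade.K2Classical

/-! ## §1 Fourier coefficients of the first derivative -/

/-- **First derivatives**: `𝓕(U')(m) = 2πi m · 𝓕(U)(m)` for a smooth `1`-periodic real profile
(Grafakos, Prop. 3.2.6 (8), through the tree's `Torus.mFourierCoeff_partialDeriv` on `𝕋¹`). -/
theorem fourierCoeff_deriv {U : ℝ → ℝ} (hU : ContDiff ℝ ∞ U) (hper : Function.Periodic U 1) (m : ℤ) :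
    fourierCoeff (AddCircle.liftIco 1 0 fun y => ((deriv U y : ℝ) : ℂ)) m =
      (2 * Real.pi * Complex.I * m) * fourierCoeff (AddCircle.liftIco 1 0 fun y => (U y : ℂ)) m := by
  have hU1 : ContDiff ℝ ∞ (deriv U) := by simpa using hU.iterate_deriv 1
  have hper1 : Function.Periodic (deriv U) 1 := ShearCascade.periodic_deriv hper
  have hsm : Torus.IsSmooth (fun z : UnitAddTorus (Fin 1) => ((U (Torus.repr z 0) : ℝ) : ℂ)) :=
    (isSmooth_coordFun_one hU hper).comp_clm Complex.ofRealCLM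
  rw [← mFourierCoeff_coordFun_one hU1.continuous hper1 m, ← mFourierCoeff_coordFun_one hU.continuous hper m]
  have hperC : Function.Periodic (fun y => ((U y : ℝ) : ℂ)) 1 := fun y => by simp only [hper y]
  have hpd : (fun z : UnitAddTorus (Fin 1) => ((deriv U (Torus.repr z 0) : ℝ) : ℂ)) =
      Torus.partialDeriv 0 (fun z : UnitAddTorus (Fin 1) => ((U (Torus.repr z 0) : ℝ) : ℂ)) := by
    funext z
    rw [Torus.partialDeriv_coordFun_self (g := fun y => ((U y : ℝ) : ℂ)) hperC 0 z]
    exact (((hU.differentiable (by simp)) _).hasDerivAt.ofReal_comp).deriv.symm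
  rw [hpd, Torus.mFourierCoeff_partialDeriv hsm 0 (Pi.single 0 m), smul_eq_mul]
  simp

/-! ## §2 The first Gaussian moment over the odd integers -/

/-- `|x| e^{−a x²} ≤ e^{−(a/2) x²}/√a` for `a > 0` (`√a|x| ≤ 1 + (a/2)x² ≤ e^{(a/2)x²}`). -/
theorem abs_mul_exp_neg_mul_sq_le {a : ℝ} (ha : 0 < a) (x : ℝ) :
    |x| * Real.exp (-a * x ^ 2) ≤ Real.exp (-(a / 2) * x ^ 2) / Real.sqrt a := by
  have hsa : 0 < Real.sqrt a := Real.sqrt_pos.2 ha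
  have hs : Real.sqrt a * |x| ≤ Real.exp ((a / 2) * x ^ 2) := by
    have h1 : Real.sqrt a * |x| ≤ 1 + (a / 2) * x ^ 2 := by
      nlinarith [sq_nonneg (Real.sqrt a * |x| - 1), Real.sq_sqrt ha.le, sq_abs x, abs_nonneg x]
    exact h1.trans (by linarith [Real.add_one_le_exp ((a / 2) * x ^ 2)])
  rw [le_div_iff₀ hsa]
  calc |x| * Real.exp (-a * x ^ 2) * Real.sqrt a
      = (Real.sqrt a * |x|) * Real.exp (-a * x ^ 2) := by ring
    _ ≤ Real.exp ((a / 2) * x ^ 2) * Real.exp (-a * x ^ 2) :=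
        mul_le_mul_of_nonneg_right hs (Real.exp_pos _).le
    _ = Real.exp (-(a / 2) * x ^ 2) := by
        rw [← Real.exp_add]
        congr 1
        ring

/-- **First Gaussian moment over the odd integers**: `Σ_{n ∈ ℤ} |2n+1| e^{−a(2n+1)²}` is summable and at most
`√(2π)/a` (`a > 0`). -/
theorem summable_abs_odd_mul_exp_neg_mul_odd_sq {a : ℝ} (ha : 0 < a) :
    Summable (fun n : ℤ => |2 * (n : ℝ) + 1| * Real.exp (-a * (2 * (n : ℝ) + 1) ^ 2)) ∧
      ∑' n : ℤ, |2 * (n : ℝ) + 1| * Real.exp (-a * (2 * (n : ℝ) + 1) ^ 2) ≤ Real.sqrt (2 * Real.pi) / a := by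
  have hsa : 0 < Real.sqrt a := Real.sqrt_pos.2 ha
  obtain ⟨hs, ht⟩ := summable_exp_neg_mul_odd_sq (half_pos ha)
  have hle : ∀ n : ℤ, |2 * (n : ℝ) + 1| * Real.exp (-a * (2 * (n : ℝ) + 1) ^ 2) ≤
      (1 / Real.sqrt a) * Real.exp (-(a / 2) * (2 * (n : ℝ) + 1) ^ 2) := fun n => by
    rw [one_div, ← div_eq_inv_mul]
    exact abs_mul_exp_neg_mul_sq_le ha _
  have hmaj : Summable fun n : ℤ => (1 / Real.sqrt a) * Real.exp (-(a / 2) * (2 * (n : ℝ) + 1) ^ 2) :=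
    hs.mul_left _
  have hsum : Summable (fun n : ℤ => |2 * (n : ℝ) + 1| * Real.exp (-a * (2 * (n : ℝ) + 1) ^ 2)) :=
    Summable.of_nonneg_of_le (fun n => by positivity) hle hmaj
  refine ⟨hsum, ?_⟩
  calc ∑' n : ℤ, |2 * (n : ℝ) + 1| * Real.exp (-a * (2 * (n : ℝ) + 1) ^ 2)
      ≤ ∑' n : ℤ, (1 / Real.sqrt a) * Real.exp (-(a / 2) * (2 * (n : ℝ) + 1) ^ 2) :=
        hsum.tsum_le_tsum hle hmaj
    _ = (1 / Real.sqrt a) * ∑' n : ℤ, Real.exp (-(a / 2) * (2 * (n : ℝ) + 1) ^ 2) := tsum_mul_left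
    _ ≤ (1 / Real.sqrt a) * Real.sqrt (Real.pi / (a / 2)) := mul_le_mul_of_nonneg_left ht (by positivity)
    _ = Real.sqrt (2 * Real.pi) / a := by
        rw [show Real.pi / (a / 2) = (2 * Real.pi) / a by field_simp, Real.sqrt_div' _ ha.le]
        rw [div_mul_div_comm, one_mul, Real.mul_self_sqrt ha.le]

/-! ## §3 The Lipschitz size of a forced profile -/

section Forced

variable {δ : ℝ} {N : ℕ} {ν κ a b : ℝ} {F : ℝ → ℝ → ℝ} {r : ℝ → ℝ}

/-- The slices of a forced profile are smooth, and so are their derivatives. -/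
theorem contDiff_deriv_slice (hF : ContDiffOn ℝ ∞ (Function.uncurry F) (Icc a b ×ˢ univ)) {t : ℝ}
    (ht : t ∈ Icc a b) : ContDiff ℝ ∞ (deriv (F t)) := by
  simpa using (contDiff_slice_of_contDiffOn_uncurry hF ht).iterate_deriv 1

/-- **Coefficient bound of the derivative of the forced profile** (`ν ≥ 0`):
`‖𝓕(∂_y F(t))(m)‖ ≤ 2π|m| · (∫ₐᵗ |r|) · 6|κ|N e^{−δ²m²/(2N²)}`. -/
theorem norm_fourierCoeff_deriv_forcedProfile_le (hδ : 0 < δ) (hN : N ≠ 0) (hab : a < b) (hν : 0 ≤ ν)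
    (hF : ContDiffOn ℝ ∞ (Function.uncurry F) (Icc a b ×ˢ univ))
    (hper : ∀ t ∈ Icc a b, Function.Periodic (F t) 1) (hF0 : F a = fun _ => 0)
    (hr : ContDiff ℝ ∞ r)
    (heat : ∀ t ∈ Icc a b, ∀ y, derivWithin (fun τ => F τ y) (Icc a b) t =
      ν * deriv (deriv (F t)) y + r t * (κ * deriv (deriv
        (fun y : ℝ => roundedSaw δ (2 * Real.pi * N * y) / (2 * Real.pi * N))) y))
    (m : ℤ) {t : ℝ} (ht : t ∈ Icc a b) :
    ‖fourierCoeff (AddCircle.liftIco 1 0 fun y => ((deriv (F t) y : ℝ) : ℂ)) m‖ ≤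
      2 * Real.pi * |(m : ℝ)| *
        ((∫ s in a..t, |r s|) * (6 * |κ| * N * Real.exp (-(δ ^ 2 * (m : ℝ) ^ 2 / (2 * (N : ℝ) ^ 2))))) := by
  have hFt : ContDiff ℝ ∞ (F t) := contDiff_slice_of_contDiffOn_uncurry hF ht
  rw [fourierCoeff_deriv hFt (hper t ht) m, norm_mul]
  have hn : ‖(2 * Real.pi * Complex.I * m : ℂ)‖ = 2 * Real.pi * |(m : ℝ)| := by
    rw [norm_mul, norm_mul, norm_mul, Complex.norm_I, mul_one, Complex.norm_intCast, Complex.norm_real,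
      Real.norm_eq_abs, abs_of_pos Real.pi_pos]
    simp
  rw [hn]
  exact mul_le_mul_of_nonneg_left (norm_fourierCoeff_forcedProfile_le hδ hN hab hν hF hper hF0 hr heat m ht)
    (by positivity)

/-- **Pointwise Lipschitz size of the forced profile** (`ν ≥ 0`):
`|∂_y F(t, y)| ≤ 24π√(2π) · |κ| N² (∫ₐᵗ |r|) / δ²` — the coefficients of `∂_y F(t)` live on the odd multiples
`m = (2n+1)N`, where `2π|m| · 6|κ|N e^{−δ²m²/(2N²)} = 12π|κ|N² · |2n+1| e^{−(δ²/2)(2n+1)²}`, and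
`Σ_n |2n+1| e^{−(δ²/2)(2n+1)²} ≤ 2√(2π)/δ²`. -/
theorem abs_deriv_forcedProfile_le (hδ : 0 < δ) (hN : N ≠ 0) (hab : a < b) (hν : 0 ≤ ν)
    (hF : ContDiffOn ℝ ∞ (Function.uncurry F) (Icc a b ×ˢ univ))
    (hper : ∀ t ∈ Icc a b, Function.Periodic (F t) 1) (hF0 : F a = fun _ => 0)
    (hr : ContDiff ℝ ∞ r)
    (heat : ∀ t ∈ Icc a b, ∀ y, derivWithin (fun τ => F τ y) (Icc a b) t =
      ν * deriv (deriv (F t)) y + r t * (κ * deriv (deriv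
        (fun y : ℝ => roundedSaw δ (2 * Real.pi * N * y) / (2 * Real.pi * N))) y))
    {t : ℝ} (ht : t ∈ Icc a b) (y : ℝ) :
    |deriv (F t) y| ≤
      24 * Real.pi * Real.sqrt (2 * Real.pi) * |κ| * (N : ℝ) ^ 2 * (∫ s in a..t, |r s|) / δ ^ 2 := by
  have hN' : (0 : ℝ) < N := Nat.cast_pos.2 (Nat.pos_of_ne_zero hN)
  have hNz : (N : ℤ) ≠ 0 := by exact_mod_cast hN
  have hπ := Real.pi_pos
  set Γ : ℝ := ∫ s in a..t, |r s| with hΓ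
  have hΓ0 : 0 ≤ Γ := intervalIntegral.integral_nonneg ht.1 fun s _ => abs_nonneg _
  set G : ℝ → ℂ := fun y => ((deriv (F t) y : ℝ) : ℂ) with hG
  have hct : Continuous (deriv (F t)) := (contDiff_deriv_slice hF ht).continuous
  have hGc : Continuous G := Complex.continuous_ofReal.comp hct
  have hGper : Function.Periodic G 1 := fun z => by
    simp only [hG, (ShearCascade.periodic_deriv (hper t ht)) z]
  set c : ℤ → ℝ := fun m => ‖fourierCoeff (AddCircle.liftIco 1 0 G) m‖ with hc
  -- the coefficients are supported on the odd multiples `(2n+1)N`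
  set g : ℤ → ℤ := fun n => (2 * n + 1) * (N : ℤ) with hg
  have hginj : Function.Injective g := by
    intro n₁ n₂ h
    have := mul_right_cancel₀ hNz h
    omega
  have hFt : ContDiff ℝ ∞ (F t) := contDiff_slice_of_contDiffOn_uncurry hF ht
  have hsupp : ∀ m ∉ Set.range g, c m = 0 := by
    intro m hm
    have hm' : ¬ ∃ n : ℤ, m = (2 * n + 1) * (N : ℤ) := by
      rintro ⟨n, hn⟩
      exact hm ⟨n, hn.symm⟩
    simp only [hc, hG]
    rw [fourierCoeff_deriv hFt (hper t ht) m,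
      fourierCoeff_forcedProfile_eq_zero hδ hN hab hF hper hF0 hr heat hm' ht, mul_zero, norm_zero]
  -- termwise bound along the odd multiples
  set a₀ : ℝ := δ ^ 2 / 2 with ha₀
  have ha₀pos : 0 < a₀ := by rw [ha₀]; positivity
  have hterm : ∀ n : ℤ, c (g n) ≤ 12 * Real.pi * |κ| * (N : ℝ) ^ 2 * Γ *
      (|2 * (n : ℝ) + 1| * Real.exp (-a₀ * (2 * (n : ℝ) + 1) ^ 2)) := by
    intro n
    have h := norm_fourierCoeff_deriv_forcedProfile_le hδ hN hab hν hF hper hF0 hr heat (g n) ht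
    have hexp : Real.exp (-(δ ^ 2 * ((g n : ℤ) : ℝ) ^ 2 / (2 * (N : ℝ) ^ 2))) =
        Real.exp (-a₀ * (2 * (n : ℝ) + 1) ^ 2) := by
      congr 1
      simp only [hg, ha₀]
      push_cast
      field_simp
    have habs : |((g n : ℤ) : ℝ)| = |2 * (n : ℝ) + 1| * N := by
      simp only [hg]
      push_cast
      rw [abs_mul, abs_of_pos hN']
    rw [hexp, habs] at h
    calc c (g n) ≤ 2 * Real.pi * (|2 * (n : ℝ) + 1| * N) *
          (Γ * (6 * |κ| * N * Real.exp (-a₀ * (2 * (n : ℝ) + 1) ^ 2))) := h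
      _ = 12 * Real.pi * |κ| * (N : ℝ) ^ 2 * Γ * (|2 * (n : ℝ) + 1| * Real.exp (-a₀ * (2 * (n : ℝ) + 1) ^ 2)) := by
          ring
  obtain ⟨hsum_odd, htsum_odd⟩ := summable_abs_odd_mul_exp_neg_mul_odd_sq ha₀pos
  have hmaj : Summable fun n : ℤ => 12 * Real.pi * |κ| * (N : ℝ) ^ 2 * Γ *
      (|2 * (n : ℝ) + 1| * Real.exp (-a₀ * (2 * (n : ℝ) + 1) ^ 2)) :=
    hsum_odd.mul_left _
  have hcg : Summable (c ∘ g) :=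
    Summable.of_nonneg_of_le (fun n => norm_nonneg _) hterm hmaj
  have hcs : Summable c := (hginj.summable_iff hsupp).1 hcg
  -- assemble
  have hpt := norm_le_tsum_norm_fourierCoeff hGc hGper hcs y
  have hGy : ‖G y‖ = |deriv (F t) y| := by simp only [hG, Complex.norm_real, Real.norm_eq_abs]
  rw [hGy] at hpt
  refine hpt.trans ?_
  change ∑' m, c m ≤ _
  have hsupp' : Function.support c ⊆ Set.range g := by
    intro m hm
    by_contra h
    exact hm (hsupp m h)
  rw [← hginj.tsum_eq hsupp']
  have hK : 0 ≤ 12 * Real.pi * |κ| * (N : ℝ) ^ 2 * Γ := by positivity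
  calc ∑' n, c (g n) ≤ ∑' n : ℤ, 12 * Real.pi * |κ| * (N : ℝ) ^ 2 * Γ *
        (|2 * (n : ℝ) + 1| * Real.exp (-a₀ * (2 * (n : ℝ) + 1) ^ 2)) :=
        Summable.tsum_le_tsum hterm hcg hmaj
    _ = 12 * Real.pi * |κ| * (N : ℝ) ^ 2 * Γ *
        ∑' n : ℤ, |2 * (n : ℝ) + 1| * Real.exp (-a₀ * (2 * (n : ℝ) + 1) ^ 2) := tsum_mul_left
    _ ≤ 12 * Real.pi * |κ| * (N : ℝ) ^ 2 * Γ * (Real.sqrt (2 * Real.pi) / a₀) :=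
        mul_le_mul_of_nonneg_left htsum_odd hK
    _ = 24 * Real.pi * Real.sqrt (2 * Real.pi) * |κ| * (N : ℝ) ^ 2 * Γ / δ ^ 2 := by
        rw [ha₀]
        field_simp
        ring

end Forced

end Summit.AnomalousDissipation.AnomalousDissipation.Theorems.SawtoothPulseCascade.ApproxResponse

end
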